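import Mathlib.Data.Multiset.DershowitzManna
import Mathlib.Data.Set.Finite.Basic
import Mathlib.Data.Finset.Image
import HarnessLib

/-!
# Route `RadicialJung`, crux `CleanModels` (stmt-15917): the Dershowitz–Manna decrease of the
# T2 termination measure from a fibrewise comparison (T2 brick B6, measure side of `stub_step`)

Support file (OURS) for PROGRAMME-clean-dim2 / T2 (`HOME/L/res-L0-w81-pv-2/g5/T2Skeleton.lean`,
architecture `T2-ARCHITECTURE.md` §B6), line `via-clean-models` of crux `DescentPerfectToAll`
(stmt-0549). Nothing here is a statement of Hironaka's manuscript; pure combinatorics of finite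
multisets.

The loop of the T2 skeleton (`phaseB`, already kernel-checked from its stubs by well-founded
induction on `Multiset.IsDershowitzMannaLT` over `ℕ`) blows up ONE Giraud-singular point `ξ` of a
stage `(X, f)` and needs the termination measure — the multiset of the entries `2·c(ξ′) + δ(ξ′)`
over the finite set of Giraud-singular points, `measure X f h = h.toFinset.val.map (entry X f)` —
to go DOWN strictly in the Dershowitz–Manna order (Giraud 1983, proof of Thm. 2.4: "on raisonne
par récurrence sur `c(X, ω)`", refined by the crossing flag `δ` for case (iii) of Lemme 2.3).
Geometrically (bricks B2/B5, other files) the blow-up `π : X₁ → X` at `ξ` is an isomorphism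
off `ξ`, so the singular points of `X₁` NOT over `ξ` correspond injectively to singular points of
`X` other than `ξ` with the SAME entry, while every singular point of `X₁` OVER `ξ` has a
STRICTLY SMALLER entry (Giraud's Lemme 2.3 (i)–(iii)). This file proves, once and for all, that
these two pointwise facts give the multiset decrease, in exactly the shape the skeleton's
`measure` has (`Set.Finite.toFinset`, `Finset.val`, `Multiset.map`):

* `isDershowitzMannaLT_add_of_forall_lt`, `isDershowitzMannaLT_add_singleton_of_forall_lt`,
  `isDershowitzMannaLT_add_of_le_of_forall_lt` — the basic pattern: `X + Y <_DM X + Z` as soon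
  as `Z ≠ 0` and every element of `Y` is below some element of `Z` (the definition, repackaged);
* `isDershowitzMannaLT_map_val_of_fibre` — **the assembly lemma** for `π : β → α`, finite
  `S ⊆ α`, `S₁ ⊆ β`, `ξ ∈ S` and entry functions `e`, `e₁` with values in any preorder: if `π`
  is injective on the part of `S₁` off the fibre of `ξ` and maps it into `S` preserving entries,
  and every point of `S₁` over `ξ` has entry `< e ξ`, then
  `S₁.toFinset.val.map e₁ <_DM S.toFinset.val.map e`;
* `isDershowitzMannaLT_map_val_of_injOn_compl_fibre` — the same with injectivity on the whole
  complement of the fibre `π ⁻¹' {ξ}` (what "`π` is an isomorphism over `X ∖ {ξ}`" delivers);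
* `isDershowitzMannaLT_map_val_of_forall_ne` — degenerate but frequent case: no singular point
  of `X₁` lies over `ξ` (the entry of `ξ` simply disappears);
* `isDershowitzMannaLT_measure_of_fibre` — the skeleton form: predicates `P`, `P₁` (the
  Giraud-singular points), entries in `ℕ`, conclusion quantified over all finiteness witnesses
  exactly as the last conjunct of `stub_step`.

## References
* N. Dershowitz, Z. Manna, Proving termination with multiset orderings, CACM 22 (1979).
* J. Giraud, Forme normale d'une fonction sur une surface de caractéristique positive,
  Bull. SMF 111 (1983), Lemme 2.3, Thm. 2.4. [Giraud1983]
-/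

set_option linter.dupNamespace false -- mandated namespace of this single-conjunct summit

namespace Summit.ResolutionOfSingularities.ResolutionOfSingularities.Theorems.RadicialJung.CleanModels.T2

open Multiset

variable {α β γ : Type*} [Preorder γ]

/-! ## The basic Dershowitz–Manna pattern -/

/-- **`X + Y <_DM X + Z`** when `Z ≠ 0` and every element of `Y` lies below some element of `Z`
(the definition of `Multiset.IsDershowitzMannaLT`, with the witnesses supplied). [folklore] -/
theorem isDershowitzMannaLT_add_of_forall_lt (X Y Z : Multiset γ) (hZ : Z ≠ 0)
    (h : ∀ y ∈ Y, ∃ z ∈ Z, y < z) : IsDershowitzMannaLT (X + Y) (X + Z) :=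
  ⟨X, Y, Z, hZ, rfl, rfl, h⟩

/-- **Replacing one element by finitely many strictly smaller ones decreases a multiset** in the
Dershowitz–Manna order: `X + Y <_DM X + {a}` when every element of `Y` is `< a`. [folklore] -/
theorem isDershowitzMannaLT_add_singleton_of_forall_lt (X Y : Multiset γ) (a : γ)
    (h : ∀ y ∈ Y, y < a) : IsDershowitzMannaLT (X + Y) (X + {a}) :=
  isDershowitzMannaLT_add_of_forall_lt X Y {a} (by simp) fun y hy => ⟨a, by simp, h y hy⟩

/-- Monotonicity in the common part: if `X ≤ X'` then `X + Y <_DM X' + {a}` when every element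
of `Y` is `< a` (the surplus `X' - X` joins the dominating part). [folklore] -/
theorem isDershowitzMannaLT_add_of_le_of_forall_lt {X X' : Multiset γ} (hX : X ≤ X')
    (Y : Multiset γ) (a : γ) (h : ∀ y ∈ Y, y < a) :
    IsDershowitzMannaLT (X + Y) (X' + {a}) := by
  obtain ⟨W, rfl⟩ := Multiset.le_iff_exists_add.mp hX
  rw [add_assoc]
  exact isDershowitzMannaLT_add_of_forall_lt X Y (W + {a}) (by simp)
    fun y hy => ⟨a, by simp, h y hy⟩

/-! ## The assembly lemma: decrease from a fibrewise comparison -/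

section Fibre

variable (π : β → α) {S : Set α} {S₁ : Set β} (hS : S.Finite) (hS₁ : S₁.Finite)
  (e : α → γ) (e₁ : β → γ) {ξ : α}

/-- **The Dershowitz–Manna decrease of the T2 measure from a fibrewise comparison.** Let
`π : β → α`, `S ⊆ α` and `S₁ ⊆ β` finite, `ξ ∈ S`, and `e : α → γ`, `e₁ : β → γ` entry
functions with values in a preorder. Suppose that (i) every point of `S₁` off the fibre of `ξ`
maps into `S` with the same entry, (ii) `π` is injective on the part of `S₁` off the fibre of
`ξ`, and (iii) every point of `S₁` over `ξ` has entry `< e ξ`. Then the multiset of entries of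
`S₁` is below that of `S` in the Dershowitz–Manna order. (In the T2 loop: `π` the blow-up of one
Giraud-singular point `ξ`, `S`, `S₁` the Giraud-singular sets, `e = 2c + δ`; (i)/(ii) because
`π` is an isomorphism off `ξ`, (iii) is Giraud's Lemme 2.3.) [cite: Giraud1983, Thm. 2.4 (proof)] -/
theorem isDershowitzMannaLT_map_val_of_fibre (hξ : ξ ∈ S)
    (hoff : ∀ x₁ ∈ S₁, π x₁ ≠ ξ → π x₁ ∈ S ∧ e₁ x₁ = e (π x₁))
    (hinj : Set.InjOn π {x₁ ∈ S₁ | π x₁ ≠ ξ})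
    (hover : ∀ x₁ ∈ S₁, π x₁ = ξ → e₁ x₁ < e ξ) :
    IsDershowitzMannaLT (hS₁.toFinset.val.map e₁) (hS.toFinset.val.map e) := by
  classical
  -- split `S₁` along the fibre of `ξ`
  set A : Finset β := hS₁.toFinset.filter fun x₁ => π x₁ ≠ ξ with hA
  set B : Finset β := hS₁.toFinset.filter fun x₁ => ¬ π x₁ ≠ ξ with hB
  have hsplit : hS₁.toFinset.val = A.val + B.val := by
    rw [hA, hB, Finset.filter_val, Finset.filter_val, Multiset.filter_add_not]
  have hAmem : ∀ x₁ ∈ A, x₁ ∈ S₁ ∧ π x₁ ≠ ξ := fun x₁ hx₁ => by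
    simpa [hA, Set.Finite.mem_toFinset] using hx₁
  have hBmem : ∀ x₁ ∈ B, x₁ ∈ S₁ ∧ π x₁ = ξ := fun x₁ hx₁ => by
    simpa [hB, Set.Finite.mem_toFinset] using hx₁
  -- the part off the fibre maps injectively into `S ∖ {ξ}` with the same entries
  have hinjA : Set.InjOn π (A : Set β) := fun x hx y hy hxy =>
    hinj ⟨(hAmem x hx).1, (hAmem x hx).2⟩ ⟨(hAmem y hy).1, (hAmem y hy).2⟩ hxy
  have hXeq : A.val.map e₁ = (A.image π).val.map e := by
    rw [Finset.image_val_of_injOn hinjA, Multiset.map_map]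
    refine Multiset.map_congr rfl fun x₁ hx₁ => ?_
    exact (hoff x₁ (hAmem x₁ hx₁).1 (hAmem x₁ hx₁).2).2
  have hsub : A.image π ⊆ hS.toFinset.erase ξ := by
    intro x hx
    obtain ⟨x₁, hx₁, rfl⟩ := Finset.mem_image.mp hx
    exact Finset.mem_erase.mpr ⟨(hAmem x₁ hx₁).2,
      (Set.Finite.mem_toFinset hS).mpr (hoff x₁ (hAmem x₁ hx₁).1 (hAmem x₁ hx₁).2).1⟩
  -- decompose `S` as (image of `A`) + (the rest, which contains `ξ`)
  have hξT : ξ ∈ hS.toFinset := (Set.Finite.mem_toFinset hS).mpr hξ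
  have hS_split : hS.toFinset.val =
      (A.image π).val + ((hS.toFinset.erase ξ) \ A.image π).val + ({ξ} : Multiset α) := by
    have h1 : hS.toFinset = insert ξ (hS.toFinset.erase ξ) := (Finset.insert_erase hξT).symm
    have h2 : (hS.toFinset.erase ξ).val =
        (A.image π).val + ((hS.toFinset.erase ξ) \ A.image π).val := by
      rw [← Finset.disjUnion_val _ _ Finset.disjoint_sdiff, Finset.disjUnion_eq_union,
        Finset.union_sdiff_of_subset hsub]
    have hξnot : ξ ∉ hS.toFinset.erase ξ := Finset.notMem_erase ξ _
    rw [← h2]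
    conv_lhs => rw [h1]
    rw [Finset.insert_val_of_notMem hξnot, ← Multiset.singleton_add, add_comm]
  rw [hsplit, Multiset.map_add, hXeq, hS_split, Multiset.map_add, Multiset.map_add,
    Multiset.map_singleton, add_assoc]
  refine isDershowitzMannaLT_add_of_forall_lt _ _ _ (by simp) fun y hy => ?_
  obtain ⟨x₁, hx₁, rfl⟩ := Multiset.mem_map.mp hy
  exact ⟨e ξ, by simp, hover x₁ (hBmem x₁ hx₁).1 (hBmem x₁ hx₁).2⟩

/-- **The same, with injectivity on the whole complement of the fibre** — the form in which an
isomorphism over `X ∖ {ξ}` delivers it. [cite: Giraud1983, Thm. 2.4 (proof)] -/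
theorem isDershowitzMannaLT_map_val_of_injOn_compl_fibre (hξ : ξ ∈ S)
    (hoff : ∀ x₁ ∈ S₁, π x₁ ≠ ξ → π x₁ ∈ S ∧ e₁ x₁ = e (π x₁))
    (hinj : Set.InjOn π (π ⁻¹' {ξ})ᶜ)
    (hover : ∀ x₁ ∈ S₁, π x₁ = ξ → e₁ x₁ < e ξ) :
    IsDershowitzMannaLT (hS₁.toFinset.val.map e₁) (hS.toFinset.val.map e) :=
  isDershowitzMannaLT_map_val_of_fibre π hS hS₁ e e₁ hξ hoff
    (hinj.mono fun _ hx => by simpa using hx.2) hover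

/-- **Degenerate case: nothing singular over `ξ`.** If no point of `S₁` lies over `ξ`, the part
of `S₁` maps injectively into `S ∖ {ξ}` preserving entries, and the entry of `ξ` disappears: the
measure still decreases (the dominating part `{e ξ}` is non-empty). [folklore] -/
theorem isDershowitzMannaLT_map_val_of_forall_ne (hξ : ξ ∈ S)
    (hne : ∀ x₁ ∈ S₁, π x₁ ≠ ξ)
    (hoff : ∀ x₁ ∈ S₁, π x₁ ∈ S ∧ e₁ x₁ = e (π x₁))
    (hinj : Set.InjOn π S₁) :
    IsDershowitzMannaLT (hS₁.toFinset.val.map e₁) (hS.toFinset.val.map e) :=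
  isDershowitzMannaLT_map_val_of_fibre π hS hS₁ e e₁ hξ (fun x₁ hx₁ _ => hoff x₁ hx₁)
    (hinj.mono fun _ hx => hx.1) fun x₁ hx₁ h => absurd h (hne x₁ hx₁)

end Fibre

/-! ## The shape used by the skeleton: subtypes of a scheme's points, entries in `ℕ` -/

/-- **Skeleton form.** For predicates `P` on `α` and `P₁` on `β` with finite extensions (the
Giraud-singular points of `X` and of `X₁`), a map `π : β → α`, `ξ` with `P ξ`, and entries
`e`, `e₁` in `ℕ`: the fibrewise comparison gives
`Multiset.IsDershowitzMannaLT (h₁.toFinset.val.map e₁) (h.toFinset.val.map e)` for ALL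
finiteness witnesses `h`, `h₁` — literally the last conjunct of the T2 skeleton's `stub_step`
(`measure X f h := h.toFinset.val.map (entry X f)`). [cite: Giraud1983, Thm. 2.4 (proof)] -/
theorem isDershowitzMannaLT_measure_of_fibre {P : α → Prop} {P₁ : β → Prop} (π : β → α)
    (e : α → ℕ) (e₁ : β → ℕ) {ξ : α} (hξ : P ξ)
    (hoff : ∀ x₁, P₁ x₁ → π x₁ ≠ ξ → P (π x₁) ∧ e₁ x₁ = e (π x₁))
    (hinj : ∀ x₁ y₁, P₁ x₁ → P₁ y₁ → π x₁ ≠ ξ → π x₁ = π y₁ → x₁ = y₁)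
    (hover : ∀ x₁, P₁ x₁ → π x₁ = ξ → e₁ x₁ < e ξ) :
    ∀ (h : {x | P x}.Finite) (h₁ : {x₁ | P₁ x₁}.Finite),
      IsDershowitzMannaLT (h₁.toFinset.val.map e₁) (h.toFinset.val.map e) :=
  fun h h₁ => isDershowitzMannaLT_map_val_of_fibre π h h₁ e e₁ hξ
    (fun x₁ hx₁ hne => hoff x₁ hx₁ hne)
    (fun x hx y hy hxy => hinj x y hx.1 hy.1 hx.2 hxy)
    (fun x₁ hx₁ heq => hover x₁ hx₁ heq)

end Summit.ResolutionOfSingularities.ResolutionOfSingularities.Theorems.RadicialJung.CleanModels.T2
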